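import Literature.Barriers.Parity.SiegelZeroDichotomyPairHLTypeIChar
import HarnessLib

/-!
# Tao–Teräväinen 2022, §8 (`k = 2`): the smooth main term reduces to a pointwise sum

Topic `Literature/Barriers/Parity`, sub-namespace `TaoTeravainen`; step (v) of the proof DAG of
`Literature.Barriers.Parity.TaoTeravainen2021_prop72_81_pair` (T. Tao, J. Teräväinen, *The
Hardy–Littlewood–Chowla conjecture in the presence of a Siegel zero*, J. London Math. Soc. (2) 106
(2022), arXiv:2109.06291), §8, case `ℓ = 0`: "Using Lemma 3.3, (8.4), and summation by parts, we can
write the left-hand side here as `∑_{d₁,…,d_k} (∏_{i<j} 1_{(d_i,d_j)∣h_i−h_j}/[d₁,…,d_k] (1/x)∫₀ˣ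
∏_j Ψ_{d_j}(y+h_j) dy + O(τ(d₁)^{O(1)}⋯ log^{O(1)} x/x))` … The contribution of those `y` with
`y ≤ x^{1−ε₀²}` is bounded by `x^{−ε₀²} log^{O(1)} x ∑ ∏ 1_{(d_i,d_j)∣h_i−h_j}/[d₁,…,d_k] τ(d₁)^{O(1)}⋯`
… Thus it will suffice to establish the pointwise bound (8.8) … for all `x^{1−ε₀²} ≤ y ≤ x`."
Everything here is PROVED, at `k = 2`, with the sum over the integers `1 ≤ n ≤ x` kept discrete (the
pointwise bound will be used at `y = n`):

* `smoothPointwise` — `G(n) := ∑_{t₁,t₂} c_{t₁} c_{t₂} crtDensity([t₁],[t₂]) Ψ((n+h₁)/d₁)Ψ((n+h₂)/d₂)`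
  over pairs of triples `t = (d, e, e')`, `c_t = χ(d)λ_eλ_{e'}`;
* `abs_smoothCorr_sub_sum_pointwise_le` — `|∑_{n≤x}(Bν)(n+h₁)(Bν)(n+h₂) - ∑_{n≤x} G(n)| ≤ sup|ψ|⁴ K_Ψ² #T²`
  (Lemma 3.3 with the count, and two summations by parts against the weights `Ψ`);
* `abs_smoothPointwise_le` — the crude bound `|G(n)| ≤ sup|ψ|⁴ |h₁−h₂| (2 sup|ψ| sup|φ| (X+2))² S_1(T)²`
  (`S_1(T) = ∑_t 1/[t] ≤ (1 + log(D⌈R⌉²))⁸`), used for `n ≤ x^{1−ε₀²}`.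
  [cite: TaoTeravainen2021, §8 (8.7)–(8.8)]
-/

noncomputable section

open Finset Real MeasureTheory
open scoped ContDiff Topology

namespace Literature.Barriers.Parity

namespace TaoTeravainen

variable {q : ℕ}

/-! ### The pointwise sum `G(n)` -/

/-- The coefficient `c_t = χ(d) λ_e λ_{e'}` of a triple `t = (d, e, e')`. [cite: TaoTeravainen2021, §8 (8.9)] -/
def smoothCoeff (χ : DirichletCharacter ℂ q) (ψ : ℝ → ℝ) (R : ℝ) (t : ℕ × ℕ × ℕ) : ℝ :=
  realChar χ t.1 * sieveWt ψ R t.2.1 * sieveWt ψ R t.2.2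

/-- `|c_t| ≤ sup|ψ|²`. [folklore] -/
theorem abs_smoothCoeff_le (χ : DirichletCharacter ℂ q) {ψ : ℝ → ℝ} {Bψ : ℝ} (hBψ : ∀ u, |ψ u| ≤ Bψ)
    (R : ℝ) (t : ℕ × ℕ × ℕ) : |smoothCoeff χ ψ R t| ≤ Bψ ^ 2 := by
  have hBψ0 : 0 ≤ Bψ := (abs_nonneg _).trans (hBψ 0)
  unfold smoothCoeff
  rw [abs_mul, abs_mul]
  calc |realChar χ t.1| * |sieveWt ψ R t.2.1| * |sieveWt ψ R t.2.2| ≤ 1 * Bψ * Bψ :=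
        mul_le_mul (mul_le_mul (abs_realChar_le_one χ _) (abs_sieveWt_le hBψ R _) (abs_nonneg _) zero_le_one)
          (abs_sieveWt_le hBψ R _) (abs_nonneg _) (by positivity)
    _ = Bψ ^ 2 := by ring

/-- **The pointwise sum** `G(y) := ∑_{t₁,t₂ ∈ T} c_{t₁} c_{t₂} crtDensity(h₁,h₂,[t₁],[t₂])
Ψ((y+h₁)/d₁) Ψ((y+h₂)/d₂)` (the left side of (8.8) at `k = 2`, before Fourier expansion).
[cite: TaoTeravainen2021, §8 (8.8)] -/
def smoothPointwise (χ : DirichletCharacter ℂ q) (φ ψ : ℝ → ℝ) (X U₀ R : ℝ) (h₁ h₂ Dmax : ℕ) (y : ℝ) : ℝ :=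
  ∑ t₁ ∈ sharpTriples R Dmax, ∑ t₂ ∈ sharpTriples R Dmax,
    smoothCoeff χ ψ R t₁ * smoothCoeff χ ψ R t₂ * crtDensity h₁ h₂ (tripleLcm t₁) (tripleLcm t₂) *
      (psiSharp φ ψ X U₀ ((y + h₁) / t₁.1) * psiSharp φ ψ X U₀ ((y + h₂) / t₂.1))

/-! ### Lemma 3.3 with two summations by parts -/

/-- **The smooth correlation is the sum of `G(n)` up to `O(1)` terms**: for `2 ≤ U₀ ≤ X + 2`,
`log(x+h_j) ≤ X + 1`, `R > 1`,
`|∑_{n ≤ x} (Bν)(n+h₁)(Bν)(n+h₂) - ∑_{n ≤ x} G(n)| ≤ sup|ψ|⁴ K_Ψ² #T_D²`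
("Using Lemma 3.3 … and summation by parts … `+ O(τ(d₁)^{O(1)}⋯ log^{O(1)} x/x)`").
[cite: TaoTeravainen2021, §8 (8.7)] -/
theorem abs_smoothCorr_sub_sum_pointwise_le (χ : DirichletCharacter ℂ q) {φ ψ : ℝ → ℝ} (hφ : IsBump φ)
    (hψ : IsSmoothCutoff ψ) {B₀ B₁ Bψ : ℝ} (hB₀ : ∀ u, |φ u| ≤ B₀) (hB₁ : ∀ u, |deriv φ u| ≤ B₁)
    (hBψ : ∀ u, |ψ u| ≤ Bψ) {X U₀ : ℝ} (hU₀ : 2 ≤ U₀) (hUX : U₀ ≤ X + 2) {R : ℝ} (hR : 1 < R)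
    {x h₁ h₂ : ℕ} (hxX₁ : Real.log ((x + h₁ : ℕ) : ℝ) ≤ X + 1) (hxX₂ : Real.log ((x + h₂ : ℕ) : ℝ) ≤ X + 1)
    (Dmax : ℕ) :
    |∑ n ∈ Icc 1 x, (sharpB χ φ ψ X U₀ Dmax (n + h₁) * selbergSieve ψ R (n + h₁)) *
          (sharpB χ φ ψ X U₀ Dmax (n + h₂) * selbergSieve ψ R (n + h₂)) -
        ∑ n ∈ Icc 1 x, smoothPointwise χ φ ψ X U₀ R h₁ h₂ Dmax n| ≤
      Bψ ^ 4 * (psiAbelConst B₀ B₁ Bψ X) ^ 2 * (#(sharpTriples R Dmax) : ℝ) ^ 2 := by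
  have hBψ0 : 0 ≤ Bψ := (abs_nonneg _).trans (hBψ 0)
  have hB₀0 : 0 ≤ B₀ := (abs_nonneg _).trans (hB₀ 0)
  have hB₁0 : 0 ≤ B₁ := (abs_nonneg _).trans (hB₁ 0)
  have hX2 : 0 ≤ X + 2 := by linarith
  have hKΨ0 : 0 ≤ psiAbelConst B₀ B₁ Bψ X := by unfold psiAbelConst; positivity
  set T := sharpTriples R Dmax with hT
  set c : ℕ × ℕ × ℕ → ℝ := smoothCoeff χ ψ R with hc
  set F : ℕ × ℕ × ℕ → ℕ → ℝ := fun t n => (if tripleLcm t ∣ n + h₁ then (1 : ℝ) else 0) *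
    psiSharp φ ψ X U₀ (((n + h₁ : ℕ) : ℝ) / t.1) with hF
  set G : ℕ × ℕ × ℕ → ℕ → ℝ := fun t n => (if tripleLcm t ∣ n + h₂ then (1 : ℝ) else 0) *
    psiSharp φ ψ X U₀ (((n + h₂ : ℕ) : ℝ) / t.1) with hG
  -- expand both slots
  have hexp : ∑ n ∈ Icc 1 x, (sharpB χ φ ψ X U₀ Dmax (n + h₁) * selbergSieve ψ R (n + h₁)) *
      (sharpB χ φ ψ X U₀ Dmax (n + h₂) * selbergSieve ψ R (n + h₂)) =
      ∑ n ∈ Icc 1 x, (∑ t₁ ∈ T, c t₁ * F t₁ n) * (∑ t₂ ∈ T, c t₂ * G t₂ n) := by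
    refine sum_congr rfl fun n hn => ?_
    rw [mem_Icc] at hn
    rw [sharpB_mul_selbergSieve_eq χ φ hψ X U₀ hR Dmax (by omega : n + h₁ ≠ 0),
      sharpB_mul_selbergSieve_eq χ φ hψ X U₀ hR Dmax (by omega : n + h₂ ≠ 0)]
    rfl
  -- the pointwise sum, with the `n`-sum innermost
  have hGsum : ∑ n ∈ Icc 1 x, smoothPointwise χ φ ψ X U₀ R h₁ h₂ Dmax n =
      ∑ t₁ ∈ T, ∑ t₂ ∈ T, c t₁ * c t₂ * ∑ n ∈ Icc 1 x,
        crtDensity h₁ h₂ (tripleLcm t₁) (tripleLcm t₂) *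
          (psiSharp φ ψ X U₀ (((n + h₁ : ℕ) : ℝ) / t₁.1) * psiSharp φ ψ X U₀ (((n + h₂ : ℕ) : ℝ) / t₂.1)) := by
    unfold smoothPointwise
    rw [sum_comm]
    refine sum_congr rfl fun t₁ _ => ?_
    rw [sum_comm]
    refine sum_congr rfl fun t₂ _ => ?_
    rw [mul_sum]
    refine sum_congr rfl fun n _ => ?_
    push_cast
    simp only [hc]
    ring
  rw [hexp, sum_mul_sum_eq_sum_sum, hGsum, ← sum_sub_distrib]
  simp_rw [← sum_sub_distrib, ← mul_sub]
  -- termwise bound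
  have hterm : ∀ t₁ ∈ T, ∀ t₂ ∈ T,
      |c t₁ * c t₂ * (∑ n ∈ Icc 1 x, F t₁ n * G t₂ n - ∑ n ∈ Icc 1 x,
        crtDensity h₁ h₂ (tripleLcm t₁) (tripleLcm t₂) *
          (psiSharp φ ψ X U₀ (((n + h₁ : ℕ) : ℝ) / t₁.1) * psiSharp φ ψ X U₀ (((n + h₂ : ℕ) : ℝ) / t₂.1)))| ≤
      Bψ ^ 2 * Bψ ^ 2 * (psiAbelConst B₀ B₁ Bψ X * (psiAbelConst B₀ B₁ Bψ X * 1)) := by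
    intro t₁ ht₁ t₂ ht₂
    obtain ⟨hd1, -, -, hL1⟩ := one_le_of_mem_sharpTriples ht₁
    obtain ⟨hd2, -, -, hL2⟩ := one_le_of_mem_sharpTriples ht₂
    rw [abs_mul, abs_mul]
    refine mul_le_mul (mul_le_mul (abs_smoothCoeff_le χ hBψ R t₁) (abs_smoothCoeff_le χ hBψ R t₂)
      (abs_nonneg _) (by positivity)) ?_ (abs_nonneg _) (by positivity)
    -- the difference as `∑ a_n Ψ₁(n) Ψ₂(n)` with `a_n = 1_{…} - dens`
    set dens := crtDensity h₁ h₂ (tripleLcm t₁) (tripleLcm t₂) with hdens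
    set a : ℕ → ℝ := fun n => (if tripleLcm t₁ ∣ n + h₁ ∧ tripleLcm t₂ ∣ n + h₂ then (1 : ℝ) else 0) - dens
      with ha
    have hdiff : ∑ n ∈ Icc 1 x, F t₁ n * G t₂ n - ∑ n ∈ Icc 1 x,
        dens * (psiSharp φ ψ X U₀ (((n + h₁ : ℕ) : ℝ) / t₁.1) * psiSharp φ ψ X U₀ (((n + h₂ : ℕ) : ℝ) / t₂.1)) =
        ∑ n ∈ Icc 1 x, (a n * psiSharp φ ψ X U₀ (((n + h₁ : ℕ) : ℝ) / t₁.1)) *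
          psiSharp φ ψ X U₀ (((n + h₂ : ℕ) : ℝ) / t₂.1) := by
      rw [← sum_sub_distrib]
      refine sum_congr rfl fun n _ => ?_
      simp only [hF, hG, ha]
      rw [show ∀ (A B P Q : ℝ), A * P * (B * Q) = (A * B) * P * Q from fun A B P Q => by ring,
        ite_zero_mul_ite_zero, one_mul]
      ring
    rw [hdiff]
    -- partial sums of `a` are `≤ 1`
    have hpa : ∀ N' ∈ Icc 1 x, |∑ n ∈ Icc 1 N', a n| ≤ 1 := by
      intro N' _
      simp only [ha]
      rw [sum_sub_distrib, sum_const, Nat.card_Icc, Nat.add_sub_cancel, nsmul_eq_mul, sum_boole]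
      exact abs_card_filter_dvd_dvd_sub_le N' h₁ h₂ (by omega) (by omega)
    -- first summation by parts (all lengths `N' ≤ x`)
    have hp1 : ∀ N' ∈ Icc 1 x, |∑ n ∈ Icc 1 N', a n * psiSharp φ ψ X U₀ (((n + h₁ : ℕ) : ℝ) / t₁.1)| ≤
        psiAbelConst B₀ B₁ Bψ X * 1 := by
      intro N' hN'
      rw [mem_Icc] at hN'
      have hN'X : Real.log ((N' + h₁ : ℕ) : ℝ) ≤ X + 1 :=
        (Real.log_le_log (by exact_mod_cast (show 0 < N' + h₁ by omega))
          (by exact_mod_cast (show N' + h₁ ≤ x + h₁ by omega))).trans hxX₁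
      exact abs_sum_mul_psiSharp_le hφ hψ hB₀ hB₁ hBψ hU₀ hUX h₁ hN'X hd1 zero_le_one
        fun N'' hN'' => hpa N'' (by rw [mem_Icc] at hN'' ⊢; omega)
    -- second summation by parts
    exact abs_sum_mul_psiSharp_le hφ hψ hB₀ hB₁ hBψ hU₀ hUX h₂ hxX₂ hd2 (by positivity) hp1
  calc |∑ t₁ ∈ T, ∑ t₂ ∈ T, c t₁ * c t₂ * (∑ n ∈ Icc 1 x, F t₁ n * G t₂ n - ∑ n ∈ Icc 1 x,
          crtDensity h₁ h₂ (tripleLcm t₁) (tripleLcm t₂) *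
            (psiSharp φ ψ X U₀ (((n + h₁ : ℕ) : ℝ) / t₁.1) * psiSharp φ ψ X U₀ (((n + h₂ : ℕ) : ℝ) / t₂.1)))|
      ≤ ∑ t₁ ∈ T, ∑ t₂ ∈ T, Bψ ^ 2 * Bψ ^ 2 * (psiAbelConst B₀ B₁ Bψ X * (psiAbelConst B₀ B₁ Bψ X * 1)) :=
        (abs_sum_le_sum_abs _ _).trans (sum_le_sum fun t₁ ht₁ =>
          (abs_sum_le_sum_abs _ _).trans (sum_le_sum fun t₂ ht₂ => hterm t₁ ht₁ t₂ ht₂))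
    _ = _ := by rw [sum_const, sum_const, nsmul_eq_mul, nsmul_eq_mul]; ring

/-! ### The crude pointwise bound -/

/-- `crtDensity ≤ |h₁ - h₂|/(L₁ L₂)` for `h₁ ≠ h₂` (the `gcd` divides `h₁ - h₂`). [folklore] -/
theorem crtDensity_le {h₁ h₂ : ℕ} (hne : h₁ ≠ h₂) {L₁ L₂ : ℕ} (hL₁ : 1 ≤ L₁) (hL₂ : 1 ≤ L₂) :
    crtDensity h₁ h₂ L₁ L₂ ≤ (Int.natAbs ((h₁ : ℤ) - h₂) : ℝ) / ((L₁ : ℝ) * L₂) := by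
  unfold crtDensity
  split_ifs with hg
  · have hg0 : 0 < Nat.gcd L₁ L₂ := Nat.gcd_pos_of_pos_left _ (by omega)
    have hD0 : (h₁ : ℤ) - h₂ ≠ 0 := sub_ne_zero.mpr (by exact_mod_cast hne)
    have hgle : Nat.gcd L₁ L₂ ≤ Int.natAbs ((h₁ : ℤ) - h₂) := by
      have := Int.natAbs_dvd_natAbs.mpr hg
      rw [Int.natAbs_natCast] at this
      exact Nat.le_of_dvd (Int.natAbs_pos.mpr hD0) this
    have hmul : (Nat.gcd L₁ L₂ : ℝ) * (Nat.lcm L₁ L₂ : ℝ) = (L₁ : ℝ) * L₂ := by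
      exact_mod_cast Nat.gcd_mul_lcm L₁ L₂
    have hlcm0 : (0 : ℝ) < Nat.lcm L₁ L₂ := by
      exact_mod_cast Nat.pos_of_ne_zero (Nat.lcm_ne_zero (by omega) (by omega))
    rw [div_le_div_iff₀ hlcm0 (by positivity), one_mul, ← hmul]
    exact mul_le_mul_of_nonneg_right (by exact_mod_cast hgle) hlcm0.le
  · positivity

/-- **The crude bound** `|G(y)| ≤ sup|ψ|⁴ |h₁−h₂| M² S₁(T)²` whenever `|Ψ((y+h_j)/d)| ≤ M` on the
triples (`S₁(T) = ∑_t 1/[t]`). [cite: TaoTeravainen2021, §8 ("Bounding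
`1_{(d_i,d_j)∣h_i−h_j}/[d₁,…,d_k] ≪ 1/(d₁⋯d_k)`")] -/
theorem abs_smoothPointwise_le (χ : DirichletCharacter ℂ q) (φ : ℝ → ℝ) {ψ : ℝ → ℝ} {Bψ : ℝ}
    (hBψ : ∀ u, |ψ u| ≤ Bψ) (X U₀ R : ℝ) {h₁ h₂ : ℕ} (hne : h₁ ≠ h₂) (Dmax : ℕ) (y : ℝ) {M : ℝ} (hM : 0 ≤ M)
    (hΨ₁ : ∀ t ∈ sharpTriples R Dmax, |psiSharp φ ψ X U₀ ((y + h₁) / t.1)| ≤ M)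
    (hΨ₂ : ∀ t ∈ sharpTriples R Dmax, |psiSharp φ ψ X U₀ ((y + h₂) / t.1)| ≤ M) :
    |smoothPointwise χ φ ψ X U₀ R h₁ h₂ Dmax y| ≤
      Bψ ^ 4 * (Int.natAbs ((h₁ : ℤ) - h₂) : ℝ) * M ^ 2 * (tripleGcdSum 1 (sharpTriples R Dmax)) ^ 2 := by
  have hBψ0 : 0 ≤ Bψ := (abs_nonneg _).trans (hBψ 0)
  set T := sharpTriples R Dmax with hT
  set H₀ : ℝ := (Int.natAbs ((h₁ : ℤ) - h₂) : ℝ) with hH₀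
  unfold smoothPointwise
  have hterm : ∀ t₁ ∈ T, ∀ t₂ ∈ T,
      |smoothCoeff χ ψ R t₁ * smoothCoeff χ ψ R t₂ * crtDensity h₁ h₂ (tripleLcm t₁) (tripleLcm t₂) *
        (psiSharp φ ψ X U₀ ((y + h₁) / t₁.1) * psiSharp φ ψ X U₀ ((y + h₂) / t₂.1))| ≤
      Bψ ^ 4 * H₀ * M ^ 2 * ((1 : ℝ) / tripleLcm t₁ * ((1 : ℝ) / tripleLcm t₂)) := by
    intro t₁ ht₁ t₂ ht₂
    obtain ⟨-, -, -, hL1⟩ := one_le_of_mem_sharpTriples ht₁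
    obtain ⟨-, -, -, hL2⟩ := one_le_of_mem_sharpTriples ht₂
    rw [abs_mul, abs_mul, abs_mul, abs_mul, abs_of_nonneg (crtDensity_nonneg _ _ _ _)]
    have hd := crtDensity_le hne hL1 hL2
    calc |smoothCoeff χ ψ R t₁| * |smoothCoeff χ ψ R t₂| * crtDensity h₁ h₂ (tripleLcm t₁) (tripleLcm t₂) *
          (|psiSharp φ ψ X U₀ ((y + h₁) / t₁.1)| * |psiSharp φ ψ X U₀ ((y + h₂) / t₂.1)|)
        ≤ Bψ ^ 2 * Bψ ^ 2 * (H₀ / ((tripleLcm t₁ : ℝ) * tripleLcm t₂)) * (M * M) := by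
          refine mul_le_mul (mul_le_mul (mul_le_mul (abs_smoothCoeff_le χ hBψ R t₁)
            (abs_smoothCoeff_le χ hBψ R t₂) (abs_nonneg _) (by positivity)) hd (crtDensity_nonneg _ _ _ _)
            (by positivity)) (mul_le_mul (hΨ₁ t₁ ht₁) (hΨ₂ t₂ ht₂) (abs_nonneg _) hM) (by positivity)
            (by positivity)
      _ = _ := by
          have h1 : (0 : ℝ) < tripleLcm t₁ := by exact_mod_cast hL1
          have h2 : (0 : ℝ) < tripleLcm t₂ := by exact_mod_cast hL2
          field_simp
  have hS : tripleGcdSum 1 T = ∑ t ∈ T, (1 : ℝ) / tripleLcm t := by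
    unfold tripleGcdSum
    refine sum_congr rfl fun t _ => ?_
    rw [Nat.gcd_one_right, Nat.cast_one, Real.sqrt_one]
  calc |∑ t₁ ∈ T, ∑ t₂ ∈ T, smoothCoeff χ ψ R t₁ * smoothCoeff χ ψ R t₂ *
        crtDensity h₁ h₂ (tripleLcm t₁) (tripleLcm t₂) *
          (psiSharp φ ψ X U₀ ((y + h₁) / t₁.1) * psiSharp φ ψ X U₀ ((y + h₂) / t₂.1))|
      ≤ ∑ t₁ ∈ T, ∑ t₂ ∈ T, Bψ ^ 4 * H₀ * M ^ 2 * ((1 : ℝ) / tripleLcm t₁ * ((1 : ℝ) / tripleLcm t₂)) :=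
        (abs_sum_le_sum_abs _ _).trans (sum_le_sum fun t₁ ht₁ =>
          (abs_sum_le_sum_abs _ _).trans (sum_le_sum fun t₂ ht₂ => hterm t₁ ht₁ t₂ ht₂))
    _ = Bψ ^ 4 * H₀ * M ^ 2 * (tripleGcdSum 1 T) ^ 2 := by
        rw [hS, sq (∑ t ∈ T, (1 : ℝ) / tripleLcm t), sum_mul_sum]
        simp only [mul_sum]

/-- `S₁(T_D) ≤ (1 + log(D⌈R⌉²))⁸`. [folklore] -/
theorem tripleGcdSum_one_le (R : ℝ) (N : ℕ) :
    tripleGcdSum 1 (sharpTriples R N) ≤ (1 + Real.log ((N * ⌈R⌉₊ ^ 2 : ℕ) : ℝ)) ^ 8 := by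
  have h := tripleGcdSum_sharpTriples_le one_ne_zero R N
  rwa [Nat.divisors_one, card_singleton, Nat.cast_one, one_pow, one_mul] at h

end TaoTeravainen

end Literature.Barriers.Parity
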